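import Summits.QuantumFields.BalabanUV.Beta.GAN24.SandwichReadoutSiteDep

/-!
# `BalabanUV.Beta.GAN24.SandwichReadoutTwoKernel` — binder row G-an2-4 ∕ (CONV-C), W-slot CT-W, the «3F-REC» induction (leaf-04 g62), tool (t1′):
# **THE SANDWICH READ-OUT FUBINI WITH TWO DIFFERENT OUTER KERNELS** — p2 g35's `SandwichReadoutSiteDep.hasSum_sandwich_readout_dep` (itself leaf-06's
# `ResolventLegCharges.hasSum_sandwich_readout` with site-dependent charges) with the left factor `K_L` and the right factor `K_R` allowed to DIFFER

NOT IN PRINT; OUR BOOKKEEPING ([folklore]; proof VERBATIM p2 g35's ∕ leaf-06's with `K ↦ K_L` on the left factor and `K ↦ K_R` on the right; G-an2-4 formalisation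
swarm, leaf prover `b2b-balaban-gan24-formalise-leaf-04`, gen 62).  HONEST FRAMING (cell contract, verbatim): «discharging `BetaPertH` makes Bałaban's UV stability
UNCONDITIONAL — a real constructive-QFT result; it is NOT the continuum limit and NOT the Clay problem.»  HONEST DEPENDENCY (verbatim): «continuum YM on T⁴ ⇐ BetaPertH ∧
nine spine estimates (0/9 proved); BetaPertH ⇐ (D1) ∧ (D4) ∧ CAP+tail; G-an2-4 gates asym, D1 and NE2/3/4.»

WHY.  The unrolling step of the three-face-legs cell law («3F_j^{(P)} = const_j · 3F_{j−1}^{(Lc·P)}», this lineage's `SpureRecSlotChargeThreeFace` ∕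
`CombKernelSheetResponse`) sums the two COARSE legs of the cubic sector `−mmRead Lc (G_j ∘ V ∘ G_j)` against two EXIT-FACE indicators `[x′_α % P = P−1]`,
`[z′_β % P = P−1]` — different weights left and right.  Absorbing each weight into its outer kernel (`K_L x y a b := [⌊x_α∕Lc⌋ % P = P−1]·G_j x y a b`,
`K_R x y a b := G_j x y a b·[⌊y_β∕Lc⌋ % P = P−1]`, both still decaying) turns the face-weighted pair sum into the PLAIN pair sum of `K_L ∘ V ∘ K_R` — so the one
thing needed beyond p2's lemma is the same Fubini with two kernels.  Nothing else changes: the majorant, the inner charge sums, the nested-composition identity.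

WHAT ([folklore]; generic `d`, `N ≥ 1`; 0 `def`, 0 cite, 0 `def … : Prop`, 0 sorry): `summable_legs_prod₂`, **`hasSum_sandwich_readout_dep₂`** — for `K_L`, `K_R` decaying
at a common rate with site-dependent coarse-leg charges `ρL` (rows of `K_L` against `inr α`) and `ρR` (columns of `K_R` against `inr β`) and a bi-localised `V`:
`HasSum ((x′,z′) ↦ (K_L ∘ V ∘ K_R)(N•x′, N•z′)_{(inr α, inr β)}) (Σ'_{(y,w)} Σ_{f,g} ρL f y · V y w f g · ρR g w)`.  Asserts NO value of Bałaban's tables; discharges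
NOTHING; NEVER «G-an2-4 closed» as (CONV-C); NOT D1, NOT BetaPertH, NOT continuum, NOT Clay.  2026-08-22; no existing file touched.
-/

noncomputable section

open Finset
open scoped BigOperators
open Literature.MathematicalPhysics.QuantumFieldTheory
open Literature.MathematicalPhysics.QuantumFieldTheory.Balaban1983to89
open Literature.MathematicalPhysics.QuantumFieldTheory.Balaban1983to89.Beta
open B12Sec2to5 (l1 l1_nonneg summable_exp_neg_l1)
open ExpKernelCalculus (Site MKer BiLoc Decays comp l1_natSmul l1_sub_triangle l1_sub_symm Zl Zl_nonneg summable_exp_shift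
  summable_exp_shift' tsum_exp_shift tsum_exp_shift')
open OneStepResolventKernel (Fib)
open AffineAveraging (box toSite)
open OneStepKernelFamily (colH)
open Summit.QuantumFields.BalabanUV.Beta.AxialDressingRooted (coDressKBmAt coDressKBmAt_inr_inr decays_coDressKBmAt)
open Summit.QuantumFields.BalabanUV.Beta.GAN24.CoDressedColumnSourceSums (rowH_coDressKBmAt summable_window_term_row tsum_source_rowH_coDressKBmAt summable_source_colH_coDressKBmAt tsum_source_colH_coDressKBmAt)
open Summit.QuantumFields.BalabanUV.Beta.GAN24.KernelLegCharges (summable_exp_coarse)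
open Summit.QuantumFields.BalabanUV.Beta.GAN24.ResolventLegCharges (summable_exp_coarse' tsum_exp_coarse_le tsum_exp_coarse_le' summable_legs_prod)

namespace Summit.QuantumFields.BalabanUV.Beta.GAN24.SandwichReadoutTwoKernel

variable {d : ℕ} {N : ℕ}

/-- [folklore] Product summability of the two coarse legs `(x′, z′) ↦ K_L (N•x′) y a f · K_R w (N•z′) g b` of two decaying kernels (leaf-06's
`summable_legs_prod`, two kernels). -/
theorem summable_legs_prod₂ [NeZero N] {KL KR : MKer (d + 1) (Fib d)} {C δ : ℝ} (hKL : Decays KL C δ) (hKR : Decays KR C δ) (hδ : 0 < δ)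
    (y w : Site (d + 1))
    (a b f g : Fib d) :
    Summable fun xz : Site (d + 1) × Site (d + 1) => KL ((N : ℤ) • xz.1) y a f * KR w ((N : ℤ) • xz.2) g b := by
  have hN : 1 ≤ N := Nat.one_le_iff_ne_zero.2 (NeZero.ne N)
  have hC : 0 ≤ C := hKL.nonneg a
  have h1 := summable_exp_coarse (d := d) hN hδ y
  have h2 := summable_exp_coarse' (d := d) hN hδ w
  have hprod := ((h1.mul_of_nonneg h2 (fun _ => (Real.exp_pos _).le) (fun _ => (Real.exp_pos _).le)).mul_left (C * C))
  refine Summable.of_norm_bounded hprod (fun xz => ?_)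
  rw [Real.norm_eq_abs, abs_mul]
  have e1 := hKL ((N : ℤ) • xz.1) y a f
  have e2 := hKR w ((N : ℤ) • xz.2) g b
  calc |KL ((N : ℤ) • xz.1) y a f| * |KR w ((N : ℤ) • xz.2) g b|
      ≤ (C * Real.exp (-δ * l1 ((N : ℤ) • xz.1 - y))) * (C * Real.exp (-δ * l1 (w - (N : ℤ) • xz.2))) :=
        mul_le_mul e1 e2 (abs_nonneg _) ((abs_nonneg _).trans e1)
    _ = _ := by ring

/-- NOT IN PRINT; OUR BOOKKEEPING ([folklore]; p2 g35's `hasSum_sandwich_readout_dep`, TWO KERNELS).  **THE SANDWICH READ-OUT FUBINI, SITE-DEPENDENT CHARGES, LEFT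
KERNEL `K_L` AND RIGHT KERNEL `K_R`**: see the module docstring. -/
theorem hasSum_sandwich_readout_dep₂ [NeZero N] {KL KR V : MKer (d + 1) (Fib d)} {C δ Cv δv : ℝ} {p q : Site (d + 1)}
    (hKL : Decays KL C δ) (hKR : Decays KR C δ) (hδ : 0 < δ)
    (hV : BiLoc V p q Cv δv) (hδv : 0 < δv) (α β : Fin (d + 1)) {ρL ρR : Fib d → Site (d + 1) → ℝ}
    (hrow : ∀ f y, HasSum (fun x' : Site (d + 1) => KL ((N : ℤ) • x') y (Sum.inr α) f) (ρL f y))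
    (hcol : ∀ g w, HasSum (fun z' : Site (d + 1) => KR w ((N : ℤ) • z') g (Sum.inr β)) (ρR g w)) :
    HasSum (fun xz : Site (d + 1) × Site (d + 1) => comp (comp KL V) KR ((N : ℤ) • xz.1) ((N : ℤ) • xz.2) (Sum.inr α) (Sum.inr β))
      (∑' yw : Site (d + 1) × Site (d + 1), ∑ f, ∑ g, ρL f yw.1 * V yw.1 yw.2 f g * ρR g yw.2) := by
  classical
  have hN : 1 ≤ N := Nat.one_le_iff_ne_zero.2 (NeZero.ne N)
  have hC : 0 ≤ C := hKL.nonneg (Sum.inl 0)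
  have hCv : 0 ≤ Cv := hV.nonneg (Sum.inl 0)
  set cF : ℝ := ((Fintype.card (Fib d) : ℕ) : ℝ) with hcF
  -- the four-leg family, outer index `(y, w)`, inner index `(x′, z′)`
  set Φ : Site (d + 1) × Site (d + 1) → Site (d + 1) × Site (d + 1) → ℝ := fun yw xz =>
    ∑ f, ∑ g, KL ((N : ℤ) • xz.1) yw.1 (Sum.inr α) f * V yw.1 yw.2 f g * KR yw.2 ((N : ℤ) • xz.2) g (Sum.inr β) with hΦ
  -- the majorant and its sums
  set U : ℝ := Real.exp (δ * ((N : ℝ) * (d + 1))) * Zl (d + 1) δ with hU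
  set M : Site (d + 1) × Site (d + 1) → Site (d + 1) × Site (d + 1) → ℝ := fun yw xz =>
    (cF * cF * (C * Cv * C) * Real.exp (-δv * (l1 (yw.1 - p) + l1 (yw.2 - q)))) *
      (Real.exp (-δ * l1 ((N : ℤ) • xz.1 - yw.1)) * Real.exp (-δ * l1 (yw.2 - (N : ℤ) • xz.2))) with hM
  have hM0 : ∀ yw xz, 0 ≤ M yw xz := fun yw xz => by positivity
  have hΦM : ∀ yw xz, |Φ yw xz| ≤ M yw xz := by
    intro yw xz
    have hterm : ∀ f g, |KL ((N : ℤ) • xz.1) yw.1 (Sum.inr α) f * V yw.1 yw.2 f g * KR yw.2 ((N : ℤ) • xz.2) g (Sum.inr β)| ≤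
        (C * Real.exp (-δ * l1 ((N : ℤ) • xz.1 - yw.1))) * (Cv * Real.exp (-δv * (l1 (yw.1 - p) + l1 (yw.2 - q)))) *
          (C * Real.exp (-δ * l1 (yw.2 - (N : ℤ) • xz.2))) := by
      intro f g
      rw [abs_mul, abs_mul]
      have e1 := hKL ((N : ℤ) • xz.1) yw.1 (Sum.inr α) f
      have e2 := hV yw.1 yw.2 f g
      have e3 := hKR yw.2 ((N : ℤ) • xz.2) g (Sum.inr β)
      exact mul_le_mul (mul_le_mul e1 e2 (abs_nonneg _) ((abs_nonneg _).trans e1)) e3 (abs_nonneg _)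
        (mul_nonneg ((abs_nonneg _).trans e1) ((abs_nonneg _).trans e2))
    calc |Φ yw xz| ≤ ∑ f, ∑ g, |KL ((N : ℤ) • xz.1) yw.1 (Sum.inr α) f * V yw.1 yw.2 f g * KR yw.2 ((N : ℤ) • xz.2) g (Sum.inr β)| :=
          (Finset.abs_sum_le_sum_abs _ _).trans (Finset.sum_le_sum fun f _ => Finset.abs_sum_le_sum_abs _ _)
      _ ≤ ∑ _f : Fib d, ∑ _g : Fib d, (C * Real.exp (-δ * l1 ((N : ℤ) • xz.1 - yw.1))) *
            (Cv * Real.exp (-δv * (l1 (yw.1 - p) + l1 (yw.2 - q)))) * (C * Real.exp (-δ * l1 (yw.2 - (N : ℤ) • xz.2))) :=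
          Finset.sum_le_sum fun f _ => Finset.sum_le_sum fun g _ => hterm f g
      _ = M yw xz := by
          simp only [Finset.sum_const, Finset.card_univ, nsmul_eq_mul, hM, hcF]
          ring
  -- inner sums of the majorant
  have hMin : ∀ yw, HasSum (fun xz => M yw xz)
      ((cF * cF * (C * Cv * C) * Real.exp (-δv * (l1 (yw.1 - p) + l1 (yw.2 - q)))) *
        ((∑' x' : Site (d + 1), Real.exp (-δ * l1 ((N : ℤ) • x' - yw.1))) *
          ∑' z' : Site (d + 1), Real.exp (-δ * l1 (yw.2 - (N : ℤ) • z')))) := by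
    intro yw
    have h1 := summable_exp_coarse (d := d) hN hδ yw.1
    have h2 := summable_exp_coarse' (d := d) hN hδ yw.2
    have h12 := h1.hasSum.mul h2.hasSum (h1.mul_of_nonneg h2 (fun _ => (Real.exp_pos _).le) (fun _ => (Real.exp_pos _).le))
    exact h12.mul_left _
  have hMs : Summable (Function.uncurry M) := by
    refine (summable_prod_of_nonneg (fun s => hM0 s.1 s.2)).2 ⟨fun yw => (hMin yw).summable, ?_⟩
    have hbound : ∀ yw : Site (d + 1) × Site (d + 1), ∑' xz, M yw xz ≤
        (cF * cF * (C * Cv * C) * (U * U)) * (Real.exp (-δv * l1 (yw.1 - p)) * Real.exp (-δv * l1 (yw.2 - q))) := by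
      intro yw
      rw [(hMin yw).tsum_eq, mul_add, Real.exp_add]
      have hA := tsum_exp_coarse_le (d := d) N hδ yw.1
      have hB := tsum_exp_coarse_le' (d := d) N hδ yw.2
      have hA0 : 0 ≤ ∑' x' : Site (d + 1), Real.exp (-δ * l1 ((N : ℤ) • x' - yw.1)) := tsum_nonneg fun _ => (Real.exp_pos _).le
      have hB0 : 0 ≤ ∑' z' : Site (d + 1), Real.exp (-δ * l1 (yw.2 - (N : ℤ) • z')) := tsum_nonneg fun _ => (Real.exp_pos _).le
      have hU0 : 0 ≤ U := mul_nonneg (Real.exp_pos _).le (Zl_nonneg hδ)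
      have hAB := mul_le_mul hA hB hB0 hU0
      have hc0 : 0 ≤ cF * cF * (C * Cv * C) * (Real.exp (-δv * l1 (yw.1 - p)) * Real.exp (-δv * l1 (yw.2 - q))) := by positivity
      calc cF * cF * (C * Cv * C) * (Real.exp (-δv * l1 (yw.1 - p)) * Real.exp (-δv * l1 (yw.2 - q))) *
            ((∑' x' : Site (d + 1), Real.exp (-δ * l1 ((N : ℤ) • x' - yw.1))) * ∑' z' : Site (d + 1), Real.exp (-δ * l1 (yw.2 - (N : ℤ) • z')))
          ≤ cF * cF * (C * Cv * C) * (Real.exp (-δv * l1 (yw.1 - p)) * Real.exp (-δv * l1 (yw.2 - q))) * (U * U) :=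
            mul_le_mul_of_nonneg_left hAB hc0
        _ = _ := by ring
    have hsum : Summable fun yw : Site (d + 1) × Site (d + 1) =>
        (cF * cF * (C * Cv * C) * (U * U)) * (Real.exp (-δv * l1 (yw.1 - p)) * Real.exp (-δv * l1 (yw.2 - q))) :=
      ((summable_exp_shift' hδv p).mul_of_nonneg (summable_exp_shift' hδv q) (fun _ => (Real.exp_pos _).le)
        (fun _ => (Real.exp_pos _).le)).mul_left _
    exact Summable.of_nonneg_of_le (fun yw => tsum_nonneg fun xz => hM0 yw xz) hbound hsum
  -- (A) absolute summability of the four-leg family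
  have hΦs : Summable (Function.uncurry Φ) :=
    Summable.of_norm_bounded hMs (fun s => by rw [Real.norm_eq_abs]; exact hΦM s.1 s.2)
  -- (C) the inner sums: only the charges survive
  have hΦin : ∀ yw : Site (d + 1) × Site (d + 1), HasSum (fun xz => Φ yw xz) (∑ f, ∑ g, ρL f yw.1 * V yw.1 yw.2 f g * ρR g yw.2) := by
    intro yw
    refine hasSum_sum fun f _ => hasSum_sum fun g _ => ?_
    have hmul := ((hrow f yw.1).mul (hcol g yw.2) (summable_legs_prod₂ hKL hKR hδ yw.1 yw.2 _ _ f g)).mul_left (V yw.1 yw.2 f g)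
    rw [show V yw.1 yw.2 f g * (ρL f yw.1 * ρR g yw.2) = ρL f yw.1 * V yw.1 yw.2 f g * ρR g yw.2 by ring] at hmul
    exact hmul.congr_fun fun xz => by ring
  -- (B) the pointwise identity: the nested composition IS the `(y, w)`-sum of `Φ`
  have hΦyw : ∀ xz : Site (d + 1) × Site (d + 1), Summable fun yw : Site (d + 1) × Site (d + 1) => Φ yw xz :=
    fun xz => hΦs.prod_symm.prod_factor xz
  have hpoint : ∀ xz : Site (d + 1) × Site (d + 1),
      comp (comp KL V) KR ((N : ℤ) • xz.1) ((N : ℤ) • xz.2) (Sum.inr α) (Sum.inr β) = ∑' yw : Site (d + 1) × Site (d + 1), Φ yw xz := by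
    intro xz
    -- summability of the `(w, y)`-ordered family and of its `y`-slices with one fibre index fixed
    have hwy : Summable fun wy : Site (d + 1) × Site (d + 1) => Φ (wy.2, wy.1) xz :=
      (Equiv.prodComm (Site (d + 1)) (Site (d + 1))).summable_iff.2 (hΦyw xz) |>.congr fun wy => rfl
    have hslice : ∀ (w : Site (d + 1)) (g : Fib d), Summable fun y : Site (d + 1) =>
        ∑ f, KL ((N : ℤ) • xz.1) y (Sum.inr α) f * V y w f g * KR w ((N : ℤ) • xz.2) g (Sum.inr β) := by
      intro w g
      have hmaj : Summable fun y : Site (d + 1) => (cF * (C * Cv * (C * Real.exp (-δ * l1 (w - (N : ℤ) • xz.2))))) *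
          Real.exp (-δ * l1 ((N : ℤ) • xz.1 - y)) := (summable_exp_shift hδ _).mul_left _
      refine Summable.of_norm_bounded hmaj (fun y => ?_)
      rw [Real.norm_eq_abs]
      have hterm : ∀ f, |KL ((N : ℤ) • xz.1) y (Sum.inr α) f * V y w f g * KR w ((N : ℤ) • xz.2) g (Sum.inr β)| ≤
          (C * Real.exp (-δ * l1 ((N : ℤ) • xz.1 - y))) * Cv * (C * Real.exp (-δ * l1 (w - (N : ℤ) • xz.2))) := by
        intro f
        rw [abs_mul, abs_mul]
        have e1 := hKL ((N : ℤ) • xz.1) y (Sum.inr α) f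
        have e2 : |V y w f g| ≤ Cv := by
          refine (hV y w f g).trans ?_
          have : Real.exp (-δv * (l1 (y - p) + l1 (w - q))) ≤ 1 :=
            Real.exp_le_one_iff.2 (by nlinarith [l1_nonneg (y - p), l1_nonneg (w - q)])
          nlinarith
        have e3 := hKR w ((N : ℤ) • xz.2) g (Sum.inr β)
        exact mul_le_mul (mul_le_mul e1 e2 (abs_nonneg _) ((abs_nonneg _).trans e1)) e3 (abs_nonneg _)
          (mul_nonneg ((abs_nonneg _).trans e1) ((abs_nonneg _).trans e2))
      calc |∑ f, KL ((N : ℤ) • xz.1) y (Sum.inr α) f * V y w f g * KR w ((N : ℤ) • xz.2) g (Sum.inr β)|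
          ≤ ∑ f, |KL ((N : ℤ) • xz.1) y (Sum.inr α) f * V y w f g * KR w ((N : ℤ) • xz.2) g (Sum.inr β)| := Finset.abs_sum_le_sum_abs _ _
        _ ≤ ∑ _f : Fib d, (C * Real.exp (-δ * l1 ((N : ℤ) • xz.1 - y))) * Cv * (C * Real.exp (-δ * l1 (w - (N : ℤ) • xz.2))) :=
            Finset.sum_le_sum fun f _ => hterm f
        _ = _ := by simp only [Finset.sum_const, Finset.card_univ, nsmul_eq_mul, hcF]; ring
    -- rewrite the nested composition
    have hinner : ∀ w : Site (d + 1), ∑ g, comp KL V ((N : ℤ) • xz.1) w (Sum.inr α) g * KR w ((N : ℤ) • xz.2) g (Sum.inr β)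
        = ∑' y : Site (d + 1), Φ (y, w) xz := by
      intro w
      have e1 : ∀ g, comp KL V ((N : ℤ) • xz.1) w (Sum.inr α) g * KR w ((N : ℤ) • xz.2) g (Sum.inr β)
          = ∑' y : Site (d + 1), ∑ f, KL ((N : ℤ) • xz.1) y (Sum.inr α) f * V y w f g * KR w ((N : ℤ) • xz.2) g (Sum.inr β) := by
        intro g
        simp only [comp]
        rw [← tsum_mul_right]
        exact tsum_congr fun y => by rw [Finset.sum_mul]
      simp_rw [e1]
      rw [(Summable.tsum_finsetSum fun g _ => hslice w g).symm]
      exact tsum_congr fun y => Finset.sum_comm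
    calc comp (comp KL V) KR ((N : ℤ) • xz.1) ((N : ℤ) • xz.2) (Sum.inr α) (Sum.inr β)
        = ∑' w : Site (d + 1), ∑' y : Site (d + 1), Φ (y, w) xz := by
          simp only [comp] at hinner ⊢
          exact tsum_congr fun w => hinner w
      _ = ∑' wy : Site (d + 1) × Site (d + 1), Φ (wy.2, wy.1) xz := (hwy.tsum_prod).symm
      _ = ∑' yw : Site (d + 1) × Site (d + 1), Φ yw xz :=
          (Equiv.prodComm (Site (d + 1)) (Site (d + 1))).tsum_eq (fun yw : Site (d + 1) × Site (d + 1) => Φ yw xz)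
  -- (D) assemble
  have hF : Summable fun xz : Site (d + 1) × Site (d + 1) => ∑' yw : Site (d + 1) × Site (d + 1), Φ yw xz := hΦs.prod_symm.prod
  have hval : ∑' xz : Site (d + 1) × Site (d + 1), ∑' yw : Site (d + 1) × Site (d + 1), Φ yw xz
      = ∑' yw : Site (d + 1) × Site (d + 1), ∑ f, ∑ g, ρL f yw.1 * V yw.1 yw.2 f g * ρR g yw.2 := by
    rw [hΦs.tsum_comm]
    exact tsum_congr fun yw => (hΦin yw).tsum_eq
  have h := hF.hasSum
  rw [hval] at h
  exact h.congr_fun fun xz => hpoint xz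

end Summit.QuantumFields.BalabanUV.Beta.GAN24.SandwichReadoutTwoKernel

end
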